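import Mathlib

/-!
# Route ConvexRankGates — crux `LinAlgGateBlind` (stmt-PneNP-10681), support:
# Kőnig–Egerváry duality (maximum matching = minimum vertex cover) for finite relations

The crux line `konig-atoms-cancellation-split` (`Cruxes/LinAlgGateBlind/Lines/…`) cuts the GRANK half
of `LinAlgGateBlind` at the *König joint*: a KÖNIG gate accepts iff the OR-pattern of its inputs has a
`θ`-matching, a HALL-COVER gate rejects iff a vertex cover with `< θ` vertices covers the pattern, and
the two presentations agree by Kőnig–Egerváry duality — the line's registered stub
`stub_konigDuality : KonigDualityStmt`. Mathlib has Hall's marriage theorem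
(`Fintype.all_card_le_filter_rel_iff_exists_injective`) but not Kőnig's `ν = τ`; this file proves it,
definition-free and in Mathlib vocabulary:

* `le_card_add_card_of_matching` — easy half: a `θ`-matching of a relation `r : α → β → Prop` forces
  every vertex cover `(A, W)` (`r a b → a ∈ A ∨ b ∈ W`) to have `θ ≤ #A + #W`.
* `exists_matching_of_forall_cover` — **Kőnig–Egerváry**: if every vertex cover has `θ ≤ #A + #W`
  then there are injective `f : Fin θ → α`, `g : Fin θ → β` with `r (f j) (g j)` for all `j`.
  Proof (defect Hall): with `δ := max_S (#S - #N(S))`, Hall's theorem for the relation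
  `α → β ⊕ Fin δ` ("`r`, or any of `δ` dummy columns") gives an injective choice function, hence a
  matching of all but `≤ δ` rows into `β` along `r`; the cover `(Sᶜ, N(S))` at a maximiser `S` has
  `card α - δ` vertices, so `θ ≤ card α - δ` and the matching restricts to `θ` rows.
* `exists_matching_iff_forall_cover` — the two halves as an `iff`.
* `konigDuality_pattern` — the `Fin d × Fin d` pattern form, literally the line's `KonigDualityStmt`
  with its (plain) definitions `IsCover` / `HasMatching` unfolded, so that the skeleton's
  `stub_konigDuality` is closed by `exact konigDuality_pattern`.

[folklore: D. Kőnig, *Gráfok és mátrixok*, Mat. Fiz. Lapok 38 (1931); J. Egerváry, *Matrixok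
kombinatorius tulajdonságairól*, ibid. (1931); textbook form Lovász–Plummer, *Matching Theory*,
Thm 1.1.1.]
-/

namespace Summit.PneNP.PneNP.Theorems

open Finset Function

/-- **Easy half of Kőnig–Egerváry.** A `θ`-matching of the relation `r` (injective rows `f`, injective
columns `g`, `r (f j) (g j)`) forces every vertex cover `(A, W)` of `r` to have at least `θ` vertices:
each matched pair consumes its own cover vertex. [folklore] -/
theorem le_card_add_card_of_matching {α β : Type*} (r : α → β → Prop) {θ : ℕ} {f : Fin θ → α}
    {g : Fin θ → β} (hf : Injective f) (hg : Injective g) (hfg : ∀ j, r (f j) (g j)) {A : Finset α}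
    {W : Finset β} (hcov : ∀ a b, r a b → a ∈ A ∨ b ∈ W) : θ ≤ #A + #W := by
  classical
  set JA : Finset (Fin θ) := univ.filter fun j => f j ∈ A with hJA
  set JW : Finset (Fin θ) := univ.filter fun j => f j ∉ A with hJW
  have hJWcol : ∀ j ∈ JW, g j ∈ W := fun j hj =>
    (hcov _ _ (hfg j)).resolve_left (mem_filter.1 hj).2
  have h1 : #JA ≤ #A :=
    calc #JA = #(JA.image f) := (card_image_of_injective _ hf).symm
      _ ≤ #A := card_le_card fun a ha => by
          obtain ⟨j, hj, rfl⟩ := mem_image.1 ha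
          exact (mem_filter.1 hj).2
  have h2 : #JW ≤ #W :=
    calc #JW = #(JW.image g) := (card_image_of_injective _ hg).symm
      _ ≤ #W := card_le_card fun w hw => by
          obtain ⟨j, hj, rfl⟩ := mem_image.1 hw
          exact hJWcol j hj
  have h3 : #JA + #JW = θ := by
    have := Finset.card_filter_add_card_filter_not (s := (univ : Finset (Fin θ))) (fun j => f j ∈ A)
    simpa [hJA, hJW] using this
  omega

/-- **Kőnig–Egerváry duality** (Kőnig 1931, Egerváry 1931) for a relation `r` between finite types:
if every vertex cover `(A, W)` of `r` (`r a b → a ∈ A ∨ b ∈ W`) satisfies `θ ≤ #A + #W`, then `r`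
contains a `θ`-matching — injective `f : Fin θ → α`, `g : Fin θ → β` with `r (f j) (g j)`. Proved from
Mathlib's Hall theorem by the defect-Hall argument (dummy columns). [folklore] -/
theorem exists_matching_of_forall_cover {α β : Type*} [Fintype α] [Fintype β] (r : α → β → Prop)
    {θ : ℕ} (hcov : ∀ (A : Finset α) (W : Finset β), (∀ a b, r a b → a ∈ A ∨ b ∈ W) → θ ≤ #A + #W) :
    ∃ (f : Fin θ → α) (g : Fin θ → β), Injective f ∧ Injective g ∧ ∀ j, r (f j) (g j) := by
  classical
  -- neighbourhoods and the Hall defect `δ = max_S (#S - #N(S))`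
  let N : Finset α → Finset β := fun S => univ.filter fun b => ∃ a ∈ S, r a b
  let δ : ℕ := (univ : Finset (Finset α)).sup fun S => #S - #(N S)
  have hδ : ∀ S : Finset α, #S ≤ #(N S) + δ := fun S => by
    have : #S - #(N S) ≤ δ := Finset.le_sup (f := fun S => #S - #(N S)) (mem_univ S)
    omega
  -- a set realising the defect
  obtain ⟨S₀, hS₀⟩ : ∃ S₀ : Finset α, #(N S₀) + δ ≤ #S₀ := by
    by_cases hδ0 : δ = 0
    · exact ⟨∅, by simp [hδ0, N]⟩
    · obtain ⟨S, -, hS⟩ :=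
        Finset.exists_mem_eq_sup (univ : Finset (Finset α)) univ_nonempty fun S => #S - #(N S)
      refine ⟨S, ?_⟩
      have hS' : δ = #S - #(N S) := hS
      omega
  -- the cover `(S₀ᶜ, N S₀)` shows `θ + δ ≤ card α`
  have hθ : θ + δ ≤ Fintype.card α := by
    have h := hcov S₀ᶜ (N S₀) fun a b hab => by
      by_cases ha : a ∈ S₀
      · exact Or.inr (mem_filter.2 ⟨mem_univ _, a, ha, hab⟩)
      · exact Or.inl (mem_compl.2 ha)
    have hc := Finset.card_add_card_compl S₀
    omega
  -- Hall with `δ` dummy columns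
  let r' : α → β ⊕ Fin δ → Prop := fun a x => Sum.elim (fun b => r a b) (fun _ => True) x
  obtain ⟨F, hFinj, hF⟩ := (Fintype.all_card_le_filter_rel_iff_exists_injective r').1 (by
    intro A
    rcases A.eq_empty_or_nonempty with rfl | ⟨a₀, ha₀⟩
    · simp
    · calc #A ≤ #(N A) + δ := hδ A
        _ = #((N A).disjSum (univ : Finset (Fin δ))) := by
            rw [card_disjSum, card_univ, Fintype.card_fin]
        _ ≤ _ := card_le_card ?_
      intro x hx
      simp only [mem_filter, mem_univ, true_and]
      rcases mem_disjSum.1 hx with ⟨b, hb, rfl⟩ | ⟨k, -, rfl⟩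
      · obtain ⟨a, ha, hab⟩ := (mem_filter.1 hb).2
        exact ⟨a, ha, by simpa [r'] using hab⟩
      · exact ⟨a₀, ha₀, by simp [r']⟩)
  -- rows matched into `β` (not into a dummy column)
  set T : Finset α := univ.filter fun a => ∃ b, F a = Sum.inl b with hTdef
  have hT : Fintype.card α ≤ #T + δ := by
    have hc : #(univ.filter fun a => ¬ ∃ b, F a = Sum.inl b) ≤ δ :=
      calc #(univ.filter fun a => ¬ ∃ b, F a = Sum.inl b)
          = #((univ.filter fun a => ¬ ∃ b, F a = Sum.inl b).image F) :=
            (card_image_of_injective _ hFinj).symm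
        _ ≤ #((univ : Finset (Fin δ)).map ⟨Sum.inr, Sum.inr_injective⟩) := card_le_card (by
            intro x hx
            obtain ⟨a, ha, rfl⟩ := mem_image.1 hx
            have ha' := (mem_filter.1 ha).2
            cases hFa : F a with
            | inl b => exact absurd ⟨b, hFa⟩ ha'
            | inr k => exact mem_map.2 ⟨k, mem_univ _, rfl⟩)
        _ = δ := by simp
    have := Finset.card_filter_add_card_filter_not (s := (univ : Finset α))
      (fun a => ∃ b, F a = Sum.inl b)
    rw [card_univ, ← hTdef] at this
    omega
  have hθT : θ ≤ #T := by omega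
  -- restrict to `θ` matched rows
  obtain ⟨e⟩ : Nonempty (Fin θ ↪ T) := Function.Embedding.nonempty_of_card_le (by simpa using hθT)
  have hcol : ∀ j : Fin θ, ∃ b, F (e j) = Sum.inl b := fun j => (mem_filter.1 (e j).2).2
  choose g hg using hcol
  refine ⟨fun j => (e j : α), g, fun j₁ j₂ h => e.injective (Subtype.ext h), fun j₁ j₂ h => ?_, fun j => ?_⟩
  · apply e.injective
    apply Subtype.ext
    apply hFinj
    rw [hg j₁, hg j₂, h]
  · have := hF (e j)
    rw [hg j] at this
    simpa [r'] using this

/-- **Kőnig–Egerváry as an equivalence**: a relation between finite types has a `θ`-matching iff every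
vertex cover has at least `θ` vertices (maximum matching = minimum vertex cover). [folklore] -/
theorem exists_matching_iff_forall_cover {α β : Type*} [Fintype α] [Fintype β] (r : α → β → Prop)
    (θ : ℕ) :
    (∃ (f : Fin θ → α) (g : Fin θ → β), Injective f ∧ Injective g ∧ ∀ j, r (f j) (g j)) ↔
      ∀ (A : Finset α) (W : Finset β), (∀ a b, r a b → a ∈ A ∨ b ∈ W) → θ ≤ #A + #W :=
  ⟨fun ⟨_, _, hf, hg, hfg⟩ _ _ hcov => le_card_add_card_of_matching r hf hg hfg hcov,
    exists_matching_of_forall_cover r⟩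

/-- **Kőnig–Egerváry duality for patterns `P ⊆ [d] × [d]`** — literally the statement
`KonigDualityStmt` of line `konig-atoms-cancellation-split` with its plain definitions `IsCover` and
`HasMatching` unfolded (so `stub_konigDuality` there is `exact konigDuality_pattern`): if every vertex
cover of `P` has at least `θ` vertices, `P` has `θ` cells with pairwise distinct rows and pairwise
distinct columns. [folklore] -/
theorem konigDuality_pattern :
    ∀ (d θ : ℕ) (P : Set (Fin d × Fin d)),
      (∀ A W : Finset (Fin d), (∀ x ∈ P, x.1 ∈ A ∨ x.2 ∈ W) → θ ≤ #A + #W) →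
        ∃ (r c : Fin θ → Fin d), Function.Injective r ∧ Function.Injective c ∧ ∀ j, (r j, c j) ∈ P :=
  fun _ _ P h =>
    exists_matching_of_forall_cover (fun a b => (a, b) ∈ P) fun A W hAW => h A W fun x hx => hAW x.1 x.2 hx

end Summit.PneNP.PneNP.Theorems
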